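import Summits.Ventures.PercRepro.S2FourteenSevenCf
import Summits.Ventures.PercRepro.S2FourteenSevenK1
import Summits.Ventures.PercRepro.S2FourteenSevenK2
import Summits.Ventures.PercRepro.S2ColoopSharp

/-!
# PercRepro — S2: THE CELL `(14, 7)` MODULO ITS SPREAD CASE (p7, gen 14; sub-claim S2; the `p = 14` row)

`RLS M 14 5` on every `e`-free core of rank `14` on `21` points, modulo the SPREAD case of its coloop-free part (`hspread`): the double coloop
split (`weighted_of_isColoop_scaled_sharp`, `_iter`) — a coloop `e` ⇒ the scaled cell `(13, 7)` coloop-free at `K₁ = 13034`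
(S2FourteenSevenK1), a second coloop `f` ⇒ the twice-scaled `(12, 7)` at `K₂ = 14474` (S2FourteenSevenK2), no coloop ⇒ S2FourteenSevenCf
(the concentrated tail at `ν = 6, 5`, THE CONTRACTION LEVER at `ν = 4`, `hspread`). **`ThmN.c025_core_five_fourteen_seven_of_spread`**.
Axioms: standard.
-/

open scoped Matroid

namespace PercRepro

namespace ThmN

open Set

variable {α : Type}

/-- **THE CELL `(14, 7)` modulo its spread case.** -/
theorem c025_core_five_fourteen_seven_of_spread
    (hspread : ∀ (M : Matroid α) [M.Finite], M.eRank = ((14 : ℕ) : ℕ∞) → M.E.ncard = 14 + 7 →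
      (∀ e ∈ M.E, ∃ A ⊆ M.E \ {e}, e ∉ M.closure A ∧ e ∉ M.closure ((M.E \ {e}) \ A)) → (∀ e, ¬ M.IsColoop e) →
      ¬ (∃ W ⊆ M.E, W.ncard ≤ 11 ∧ W.encard = M.eRk W + 6) → ¬ (∃ W ⊆ M.E, W.ncard ≤ 10 ∧ W.encard = M.eRk W + 5) →
      ¬ (∃ W ⊆ M.E, W.ncard ≤ 9 ∧ W.encard = M.eRk W + 4) → RLS M 14 5)
    (M : Matroid α) [M.Finite]
    (hR : M.eRank = ((14 : ℕ) : ℕ∞)) (hn : M.E.ncard = 14 + 7)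
    (hfree : ∀ e ∈ M.E, ∃ A ⊆ M.E \ {e}, e ∉ M.closure A ∧ e ∉ M.closure ((M.E \ {e}) \ A)) : RLS M 14 5 := by
  classical
  by_cases hK : ∃ e, M.IsColoop e
  · obtain ⟨e, he⟩ := hK
    obtain ⟨hn', hR', hfree', -⟩ := delete_core_data M he (p := 13) (d := 7) (by rw [hR]) hn hfree
    rw [RLS_iff]
    by_cases hK' : ∃ f, (M ＼ {e}).IsColoop f
    · obtain ⟨f, hf⟩ := hK'
      obtain ⟨hn'', hR'', hfree'', -⟩ := delete_core_data (M ＼ {e}) hf (p := 12) (d := 7) (by rw [hR']) hn' hfree'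
      have key := c025_twelve_seven_k2 ((M ＼ {e}) ＼ {f}) hR'' hn'' hfree''
      exact weighted_of_isColoop_scaled_sharp_iter M he hf (by norm_num : 4 + 1 < 12) (by rw [hR]) (phiK 14 5) key
    · push Not at hK'
      have key := c025_thirteen_seven_cfk1 (M ＼ {e}) hR' hn' hfree' hK'
      exact weighted_of_isColoop_scaled_sharp M he (by norm_num : 4 + 1 < 13) (by rw [hR]) (phiK 14 5) key
  · push Not at hK
    exact c025_fourteen_seven_cf_of_spread hspread M hR hn hfree hK

end ThmN

end PercRepro
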